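import Summits.ResolutionOfSingularities.ResolutionOfSingularities.Theorems.EquisingularLiftEquisingularLiftNatCompleteIntersectionLiftNose
import Summits.ResolutionOfSingularities.ResolutionOfSingularities.Theorems.EquisingularLiftEquisingularLiftNatCompleteIntersectionLiftKey
import Summits.ResolutionOfSingularities.ResolutionOfSingularities.Theorems.EquisingularLiftEquisingularLiftNatCompleteIntersectionLiftSmooth
import Summits.ResolutionOfSingularities.ResolutionOfSingularities.Theorems.EquisingularLiftEquisingularLiftNatCompleteIntersectionLiftJacobian
import Literature.AlgebraicGeometry.Motives.Varieties
import HarnessLib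

/-!
# [OURS · L1 W4.5(b) · EL♮(3)] T-LIFT-CI — THE (LIFT) SUPPLIER of `stub_elnat_ciNoseThenPoints`: smooth complete intersections of `ℙⁿ_k`
# LIFT to `O`-SMOOTH centres of `ℙⁿ_O` with the prescribed special fibre, for EVERY complete DVR `O ↠ k`

Cell `res-hironaka`, rung L, slot W4.5(b); crux **EL♮(3)** (stmt-ResolutionOfSingularities-20148; parent stmt-20038), registered stub
`stub_elnat_ciNoseThenPoints` (res-L1-w45b-lead-2 RESHAPE v6, 2026-08-27T08:54:27Z). OURS; NOT a statement of any manuscript; AI-written,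
weaker than expert review. No definition, no `sorry`, standard axioms. `--supports stmt-ResolutionOfSingularities-20148 --as helper`.

**`ciLift`** is hypothesis (LIFT) of lead-2's assembly `stub_elnat_ciNoseThenPoints_of_suppliers` (HOME L/res-L1-w45b-lead-2/CiNoseThenPointsOfSuppliers.lean)
VERBATIM: for `k` algebraically closed and EVERY complete DVR `O` with `π : O ↠ k`, homogeneous forms `f₁,…,f_c` of degrees `d_i ≥ 1` whose common
zero SET `Σ ⊂ ℙⁿ_k` is non-empty and satisfies the Jacobian-minor clause (`∀ y ∈ Σ, ∃ e : Fin c ↪ Fin (n+1), det(∂f_i/∂x_{e j}) ∉ 𝔮_y`) admit an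
ideal sheaf `C` on `ℙⁿ_O` with `V(C) → Spec O` SMOOTH and `C · 𝒪_{ℙⁿ_k} = 𝓘_Σ` along EVERY graded `φ` over `π`. Witness: `C = (F̃₁,…,F̃_c)~` for ANY
homogeneous lifts `F̃_i` (`exists_homogeneous_lift`). Assembly of the T-LIFT-CI chain: part 1 `…LiftAlgebra` (cotangent lift, p517176) · part 2
`…LiftCentre` (Regular ∧ Flat from stalk data, p518941) · part 3 `…LiftProj` (stalk generators, base change, p518108) · part 4 `…LiftNose`
(`isRegular_and_flat_ciNose`, p520182) · part 5 `…LiftKey` (hKEY exactness `(f)~ = 𝓘_Σ`) — res-D-pv-027 AS res-L1-s36-pv-4; CI-JAC `…LiftJacobian`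
((J) ⇒ (J′), p520360) and T4 `…LiftSmooth` (`smooth_ciNose_of_flat`, over res-type-027's `LiftsEmbedded.smooth`) — res-type-051.

References: Matsumura (1986) Thms. 14.2, 14.3, 30.4 [Matsumura1987]; Hartshorne (1977) II Prop. 5.9, III Prop. 9.7, III Thm. 10.2 [Hartshorne1977];
Liu (2002) Prop. 3.1.9 [Liu2002]; Stacks 01V8 [StacksProject]; cell: TARGET-CINOSE / skeleton v6 / CiNoseThenPointsOfSuppliers (lead-2).
-/

set_option linter.dupNamespace false -- mandated namespace `Summit.<Summit>.<Problem>` of this single-conjunct summit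
set_option linter.overlappingInstances false -- signatures carry `[IsDomain O] [IsDiscreteValuationRing O]`

noncomputable section

open CategoryTheory AlgebraicGeometry TopologicalSpace IsLocalRing
open MvPolynomial HomogeneousLocalization
open Literature.AlgebraicGeometry.Resolution
open Summit.ResolutionOfSingularities.ResolutionOfSingularities.Cruxes.EquisingularLift.StrataSplit

attribute [local instance] MvPolynomial.gradedAlgebra

namespace Summit.ResolutionOfSingularities.ResolutionOfSingularities.Cruxes.EquisingularLiftNat.Sections

namespace CILift

/-- **Homogeneous lifts along a surjection of coefficient rings**: a form of degree `d` over `k` is the reduction of a form of degree `d`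
over `O` (lift each coefficient). [folklore] -/
theorem exists_homogeneous_lift {O k σ : Type*} [CommRing O] [CommRing k] (π : O →+* k)
    (hπ : Function.Surjective π) {d : ℕ} (f : MvPolynomial σ k) (hf : f ∈ homogeneousSubmodule σ k d) :
    ∃ F : MvPolynomial σ O, F ∈ homogeneousSubmodule σ O d ∧ MvPolynomial.map π F = f := by
  classical
  let s : k → O := Function.surjInv hπ
  have hs : ∀ a, π (s a) = a := Function.surjInv_eq hπ
  refine ⟨∑ m ∈ f.support, monomial m (s (coeff m f)), ?_, ?_⟩
  · refine Submodule.sum_mem _ fun m hm => ?_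
    have hdeg : m.degree = d := by
      have h := (mem_homogeneousSubmodule d f).mp hf (mem_support_iff.mp hm)
      rw [Finsupp.degree_eq_weight_one]
      exact h
    exact (mem_homogeneousSubmodule d _).mpr (isHomogeneous_monomial _ hdeg)
  · rw [map_sum]
    simp only [map_monomial, hs]
    exact (MvPolynomial.as_sum f).symm

/-- Over a local ring `O` with a surjection `π` onto a field, a uniformiser (indeed every non-unit) is killed by `π`
(`ker π` is maximal, hence the maximal ideal). [folklore] -/
theorem map_eq_zero_of_irreducible {O k : Type} [CommRing O] [IsLocalRing O] [Field k] (π : O →+* k)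
    (hπ : Function.Surjective π) {ϖ : O} (hϖ : Irreducible ϖ) : π ϖ = 0 := by
  have hker : RingHom.ker π = maximalIdeal O := IsLocalRing.eq_maximalIdeal (RingHom.ker_isMaximal_of_surjective π hπ)
  have h : ϖ ∈ RingHom.ker π := by
    rw [hker]
    exact (mem_maximalIdeal _).mpr hϖ.not_isUnit
  exact h

/-- **(LIFT) — smooth complete intersections lift, with prescribed special fibre, over every complete DVR** (the hypothesis `hLIFT` of
res-L1-w45b-lead-2's `stub_elnat_ciNoseThenPoints_of_suppliers`, VERBATIM). [cite: Hartshorne1977, III Thm. 10.2; Matsumura1987, Thm. 30.4 (ii)] -/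
theorem ciLift (k : Type) [Field k] [IsAlgClosed k] (n : ℕ) :
    ∀ (O : Type) [CommRing O] [IsDomain O] [IsDiscreteValuationRing O] [IsAdicComplete (IsLocalRing.maximalIdeal O) O]
      [IsAlgClosed (IsLocalRing.ResidueField O)] (π : O →+* k), Function.Surjective π →
      (letI := MvPolynomial.gradedAlgebra (σ := Fin (n + 1)) (R := O);
       letI := MvPolynomial.gradedAlgebra (σ := Fin (n + 1)) (R := k);
       ∀ (c : ℕ) (f : Fin c → MvPolynomial (Fin (n + 1)) k) (d : Fin c → ℕ),
        (∀ i, 1 ≤ d i ∧ f i ∈ MvPolynomial.homogeneousSubmodule (Fin (n + 1)) k (d i)) →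
        Set.Nonempty {y : (Literature.AlgebraicGeometry.Motives.projectiveSpace n k).left |
          ∀ i, f i ∈ (y : ProjectiveSpectrum (MvPolynomial.homogeneousSubmodule (Fin (n + 1)) k)).asHomogeneousIdeal} →
        (∀ y ∈ {y : (Literature.AlgebraicGeometry.Motives.projectiveSpace n k).left |
            ∀ i, f i ∈ (y : ProjectiveSpectrum (MvPolynomial.homogeneousSubmodule (Fin (n + 1)) k)).asHomogeneousIdeal},
          ∃ e : Fin c ↪ Fin (n + 1), Matrix.det (Matrix.of fun i j => MvPolynomial.pderiv (e j) (f i)) ∉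
            (y : ProjectiveSpectrum (MvPolynomial.homogeneousSubmodule (Fin (n + 1)) k)).asHomogeneousIdeal) →
        ∀ (hSig : IsClosed {y : (Literature.AlgebraicGeometry.Motives.projectiveSpace n k).left |
            ∀ i, f i ∈ (y : ProjectiveSpectrum (MvPolynomial.homogeneousSubmodule (Fin (n + 1)) k)).asHomogeneousIdeal}),
        ∃ C : (AlgebraicGeometry.Proj (MvPolynomial.homogeneousSubmodule (Fin (n + 1)) O)).IdealSheafData,
          AlgebraicGeometry.Smooth (C.subschemeι ≫ (Proj.toSpecZero (MvPolynomial.homogeneousSubmodule (Fin (n + 1)) O) ≫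
              Spec.map (CommRingCat.ofHom (algebraMap O ((MvPolynomial.homogeneousSubmodule (Fin (n + 1)) O) 0))))) ∧
          ∀ (φ : (MvPolynomial.homogeneousSubmodule (Fin (n + 1)) O) →+*ᵍ (MvPolynomial.homogeneousSubmodule (Fin (n + 1)) k))
            (hφ' : HomogeneousIdeal.irrelevant (MvPolynomial.homogeneousSubmodule (Fin (n + 1)) k) ≤
              (HomogeneousIdeal.irrelevant (MvPolynomial.homogeneousSubmodule (Fin (n + 1)) O)).map φ),
            (∀ s, φ s = MvPolynomial.map π s) →
              C.comap (AlgebraicGeometry.Proj.map φ hφ') =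
                AlgebraicGeometry.Scheme.IdealSheafData.vanishingIdeal
                  (⟨{y : (Literature.AlgebraicGeometry.Motives.projectiveSpace n k).left |
                      ∀ i, f i ∈ (y : ProjectiveSpectrum (MvPolynomial.homogeneousSubmodule (Fin (n + 1)) k)).asHomogeneousIdeal}, hSig⟩ :
                    TopologicalSpace.Closeds (Literature.AlgebraicGeometry.Motives.projectiveSpace n k).left)) := by
  intro O _ _ _ _ _ π hπ c f d hfd hne hjac hSig
  -- homogeneous lifts of the forms
  have hf : ∀ l, f l ∈ homogeneousSubmodule (Fin (n + 1)) k (d l) := fun l => (hfd l).2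
  choose F hF hFf using fun l => exists_homogeneous_lift π hπ (f l) (hf l)
  -- the coefficient map as a graded homomorphism (any `φ` over `π` agrees with it pointwise)
  let φ₀ : (homogeneousSubmodule (Fin (n + 1)) O) →+*ᵍ (homogeneousSubmodule (Fin (n + 1)) k) :=
    ⟨MvPolynomial.map π, fun h => h.map π⟩
  have hφ₀ : ∀ s, φ₀ s = MvPolynomial.map π s := fun _ => rfl
  have hφ₀' := ProjectiveAmbientFibre.irrelevant_le_map_gradedMap π φ₀ hφ₀
  -- a uniformiser, killed by `π`
  obtain ⟨ϖ, hϖ⟩ := IsDiscreteValuationRing.exists_irreducible O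
  have hπϖ : π ϖ = 0 := map_eq_zero_of_irreducible π hπ hϖ
  -- the Jacobian clause, pointwise, and the stalk-level transversality (J′) it yields (CI-JAC)
  have hjac' : ∀ y : Proj (homogeneousSubmodule (Fin (n + 1)) k), (∀ l, f l ∈ y.asHomogeneousIdeal) →
      ∃ e : Fin c ↪ Fin (n + 1), (Matrix.of fun i j => MvPolynomial.pderiv (e j) (f i)).det ∉ y.asHomogeneousIdeal :=
    fun y hy => hjac y hy
  have hJ' : ∀ y : Proj (homogeneousSubmodule (Fin (n + 1)) k), (∀ l, f l ∈ y.asHomogeneousIdeal) →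
      ∃ (i : Fin (n + 1)) (hyi : y ∈ Proj.basicOpen (homogeneousSubmodule (Fin (n + 1)) k) (X i)),
        ∀ b : Fin c → (Proj (homogeneousSubmodule (Fin (n + 1)) k)).presheaf.stalk y,
          ∑ l, b l * ((Proj (homogeneousSubmodule (Fin (n + 1)) k)).presheaf.germ
              (Proj.basicOpen (homogeneousSubmodule (Fin (n + 1)) k) (X i)) y hyi).hom
            ((Proj.awayToSection (homogeneousSubmodule (Fin (n + 1)) k) (X i)).hom
              (mk₁ (homogeneousSubmodule (Fin (n + 1)) k) (X_mem_one' i) (d l) (f l) (hf l))) ∈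
            maximalIdeal ((Proj (homogeneousSubmodule (Fin (n + 1)) k)).presheaf.stalk y) ^ 2 →
          ∀ l, b l ∈ maximalIdeal ((Proj (homogeneousSubmodule (Fin (n + 1)) k)).presheaf.stalk y) :=
    fun y hy => downstairs_of_jacobianMinor f d hf y hy (hjac' y hy)
  have hJsupp : ∀ y ∈ ((projIdealSheaf (homogeneousSubmodule (Fin (n + 1)) k)
        ⟨Ideal.span (Set.range f), isHomogeneous_span_of_forall_mem _ f d hf⟩).support :
          Set (Proj (homogeneousSubmodule (Fin (n + 1)) k))),
      ∃ (i : Fin (n + 1)) (hyi : y ∈ Proj.basicOpen (homogeneousSubmodule (Fin (n + 1)) k) (X i)),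
        ∀ b : Fin c → (Proj (homogeneousSubmodule (Fin (n + 1)) k)).presheaf.stalk y,
          ∑ l, b l * ((Proj (homogeneousSubmodule (Fin (n + 1)) k)).presheaf.germ
              (Proj.basicOpen (homogeneousSubmodule (Fin (n + 1)) k) (X i)) y hyi).hom
            ((Proj.awayToSection (homogeneousSubmodule (Fin (n + 1)) k) (X i)).hom
              (mk₁ (homogeneousSubmodule (Fin (n + 1)) k) (X_mem_one' i) (d l) (f l) (hf l))) ∈
            maximalIdeal ((Proj (homogeneousSubmodule (Fin (n + 1)) k)).presheaf.stalk y) ^ 2 →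
          ∀ l, b l ∈ maximalIdeal ((Proj (homogeneousSubmodule (Fin (n + 1)) k)).presheaf.stalk y) := by
    intro y hy
    rw [support_projIdealSheaf_span f d hf] at hy
    exact hJ' y hy
  refine ⟨projIdealSheaf (homogeneousSubmodule (Fin (n + 1)) O)
    ⟨Ideal.span (Set.range F), isHomogeneous_span_of_forall_mem _ F d hF⟩, ?_, ?_⟩
  · -- SMOOTH: regular and flat (part 4) ⇒ smooth (T4, res-type-051)
    have hrf := isRegular_and_flat_ciNose O ϖ hϖ π hπ hπϖ φ₀ hφ₀' hφ₀ F f d hF hf hFf hJsupp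
    exact smooth_ciNose_of_flat π hπ φ₀ hφ₀' hφ₀ F f d hF hf hFf hjac' hrf.2
  · -- hKEY for every `φ` over `π`
    intro φ hφ' hφ
    have hφX : ∀ i : Fin (n + 1), φ (X i) = X i := fun i => by rw [hφ, map_X]
    have hφF : ∀ l, φ (F l) = f l := fun l => by rw [hφ, hFf]
    exact comap_projIdealSheaf_span_eq_vanishingIdeal φ hφ' hφX F f d hF hf hφF hJ' hSig

end CILift

end Summit.ResolutionOfSingularities.ResolutionOfSingularities.Cruxes.EquisingularLiftNat.Sections

end
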